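import Summits.Ventures.PercRepro.S2FourteenSevenNuFour
import Summits.Ventures.PercRepro.S2TopSixSeven
import Summits.Ventures.PercRepro.S2NullityLever
import Summits.Ventures.PercRepro.S2CircuitNullity
import Summits.Ventures.PercRepro.S2TopSixThrough
import Summits.Ventures.PercRepro.S2TwoAvoidingCircuits
import Summits.Ventures.PercRepro.S2IndepFiveCount
import Summits.Ventures.PercRepro.S2SpreadTail
import Summits.Ventures.PercRepro.S2BasesTriangles

/-!
# PercRepro — S2: THE SPREAD CASE OF THE CELL `(14, 7)` COLOOP-FREE AT `9` TRIANGLES (p7, gen 14; sub-claim S2)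

The row `t = 9` of the spread case of the cell `(14, 7)`: **`c025_fourteen_seven_cf_spread_nine`**. With `9` triangles at
most `6` meet a given triangle `T`, so `≥ 2` avoid it. Per triangle the charge is `≤ 530`: (a) three avoiding triangles —
their union has nullity `≥ 3` and `≤ 9` points, the nullity lever gives `≤ 408`; (b) two avoiding triangles `D₁, D₂` sharing
a point — a top `6`-set through `T` meets `D₁ ∪ D₂` (5 points): `≤ 816 − C(13, 3) = 530`; (c) `D₁, D₂` disjoint and a
`4`-circuit `Q` avoiding `T` (**`exists_four_circuit_disjoint_of_six_le`**: with `≤ 2` avoiding triangles some point of `T`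
carries two further triangles) not inside `D₁ ∪ D₂` — `D₁ ∪ D₂ ∪ Q` has nullity `≥ 3` (`S2.eRk_union_three_add_three_le_encard`)
and `≤ 10` points: `≤ 480`; (d) `Q ⊆ D₁ ∪ D₂` — `Q` has two points on each `Dᵢ`, so `D₁ ∪ D₂ ⊆ cl Q` has rank `3` and
nullity `3` on `6` points: `≤ 200`. The row: `(U, S, m) = (44518, 137288, 103)`, ratio `0.9966`. Axioms: standard.
-/

open scoped Matroid

namespace PercRepro

namespace S2

open Set

variable {α : Type}

/-- **A `4`-circuit avoiding `T`** whenever the triangles outnumber the avoiding ones by `≥ 5`: some point of `T` carries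
two further triangles (at most two through each point), and their quadruple is a `4`-circuit. -/
theorem exists_four_circuit_disjoint_of_six_le (M : Matroid α) [M.Finite]
    (hC1 : ∀ L ⊆ M.E, M.eRk L = 2 → L.ncard ≤ 3)
    (hs : ∀ e ∈ M.E, ∀ f ∈ M.E, e ≠ f → M.eRk {e, f} = 2)
    (h9 : ∀ X ⊆ M.E, X.ncard ≤ 9 → X.encard ≤ M.eRk X + 3)
    {T : Set α} (hT : M.IsCircuit T) (hT3 : T.ncard = 3)
    (hk : {C : Set α | M.IsCircuit C ∧ C.ncard = 3 ∧ Disjoint C T}.ncard + 5 ≤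
      {C : Set α | M.IsCircuit C ∧ C.ncard = 3}.ncard) :
    ∃ Q : Set α, M.IsCircuit Q ∧ Q.ncard = 4 ∧ Disjoint Q T := by
  classical
  set 𝒯 := {C : Set α | M.IsCircuit C ∧ C.ncard = 3} with h𝒯
  have h𝒯fin : 𝒯.Finite := M.ground_finite.finite_subsets.subset (fun C hC => hC.1.subset_ground)
  set 𝒟 := {C : Set α | M.IsCircuit C ∧ C.ncard = 3 ∧ Disjoint C T} with h𝒟
  have h𝒟fin : 𝒟.Finite := h𝒯fin.subset (fun C hC => ⟨hC.1, hC.2.1⟩)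
  have hfinS : ∀ w : α, ({T' ∈ 𝒯 | T' ≠ T ∧ w ∈ T'} : Set (Set α)).Finite :=
    fun _ => h𝒯fin.subset (fun C hC => hC.1)
  have hthrough : ∀ u ∈ T, ({T' ∈ 𝒯 | T' ≠ T ∧ u ∈ T'} : Set (Set α)).ncard ≤ 2 := by
    intro u huT
    by_contra hlt
    push Not at hlt
    obtain ⟨T₂, T₃, T₄, h2, h3, h4, h23, h24, h34⟩ := (Set.two_lt_ncard_iff (hfinS u)).1 hlt
    exact not_four_triangles_through M hC1 h9 hT hT3 huT h2.1.1 h2.1.2 h2.2.2 h3.1.1 h3.1.2 h3.2.2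
      h4.1.1 h4.1.2 h4.2.2 (Ne.symm h2.2.1) (Ne.symm h3.2.1) (Ne.symm h4.2.1) h23 h24 h34
  have hpair : ∀ u ∈ T, 2 ≤ ({T' ∈ 𝒯 | T' ≠ T ∧ u ∈ T'} : Set (Set α)).ncard →
      ∃ Q : Set α, M.IsCircuit Q ∧ Q.ncard = 4 ∧ Disjoint Q T := by
    intro u hu h2u
    obtain ⟨T', T'', hT', hT'', hne⟩ := (Set.one_lt_ncard_iff (hfinS u)).1 (by omega)
    obtain ⟨Q, hQ, hQ4, hQT, -⟩ := exists_four_circuit_of_two_triangles_through M hC1 hs hT hT3 hT'.1.1 hT'.1.2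
      hT''.1.1 hT''.1.2 hT'.2.1 hT''.2.1 hne hu hT'.2.2 hT''.2.2
    exact ⟨Q, hQ, hQ4, hQT⟩
  obtain ⟨x, y, z, hxy, hxz, hyz, hTxyz⟩ := Set.ncard_eq_three.1 hT3
  have hxT : x ∈ T := by rw [hTxyz]; exact Set.mem_insert x _
  have hyT : y ∈ T := by rw [hTxyz]; exact Set.mem_insert_of_mem x (Set.mem_insert y _)
  have hzT : z ∈ T := by
    rw [hTxyz]; exact Set.mem_insert_of_mem x (Set.mem_insert_of_mem y (Set.mem_singleton z))
  set Sx := ({T' ∈ 𝒯 | T' ≠ T ∧ x ∈ T'} : Set (Set α)) with hSx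
  set Sy := ({T' ∈ 𝒯 | T' ≠ T ∧ y ∈ T'} : Set (Set α)) with hSy
  set Sz := ({T' ∈ 𝒯 | T' ≠ T ∧ z ∈ T'} : Set (Set α)) with hSz
  have hcover : 𝒯 ⊆ ({T} ∪ ((Sx ∪ Sy) ∪ Sz)) ∪ 𝒟 := by
    intro T' hT'
    by_cases hne : T' = T
    · exact Or.inl (Or.inl (Set.mem_singleton_iff.2 hne))
    by_cases hdis : Disjoint T' T
    · exact Or.inr ⟨hT'.1, hT'.2, hdis⟩
    · rw [Set.not_disjoint_iff] at hdis
      obtain ⟨w, hwT', hwT⟩ := hdis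
      rw [hTxyz] at hwT
      simp only [Set.mem_insert_iff, Set.mem_singleton_iff] at hwT
      rcases hwT with rfl | rfl | rfl
      · exact Or.inl (Or.inr (Or.inl (Or.inl ⟨hT', hne, hwT'⟩)))
      · exact Or.inl (Or.inr (Or.inl (Or.inr ⟨hT', hne, hwT'⟩)))
      · exact Or.inl (Or.inr (Or.inr ⟨hT', hne, hwT'⟩))
  have hle := Set.ncard_le_ncard hcover
    (((Set.finite_singleton T).union (((hfinS x).union (hfinS y)).union (hfinS z))).union h𝒟fin)
  have hu1 := Set.ncard_union_le ({T} ∪ ((Sx ∪ Sy) ∪ Sz)) 𝒟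
  have hu2 := Set.ncard_union_le ({T} : Set (Set α)) ((Sx ∪ Sy) ∪ Sz)
  have hu3 := Set.ncard_union_le (Sx ∪ Sy) Sz
  have hu4 := Set.ncard_union_le Sx Sy
  rw [Set.ncard_singleton] at hu2
  have hx2 : Sx.ncard ≤ 2 := hthrough x hxT
  have hy2 : Sy.ncard ≤ 2 := hthrough y hyT
  have hz2 : Sz.ncard ≤ 2 := hthrough z hzT
  rcases (by omega : 2 ≤ Sx.ncard ∨ 2 ≤ Sy.ncard ∨ 2 ≤ Sz.ncard) with ha | hb | hc
  · exact hpair x hxT ha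
  · exact hpair y hyT hb
  · exact hpair z hzT hc

end S2

namespace ThmN

open Set

variable {α : Type}

/-- **The spread case of the coloop-free cell `(14, 7)` at `9` triangles.** -/
theorem c025_fourteen_seven_cf_spread_nine (M : Matroid α) [M.Finite]
    (hR : M.eRank = ((14 : ℕ) : ℕ∞)) (hn : M.E.ncard = 14 + 7)
    (hfree : ∀ e ∈ M.E, ∃ A ⊆ M.E \ {e}, e ∉ M.closure A ∧ e ∉ M.closure ((M.E \ {e}) \ A)) (hK : ∀ e, ¬ M.IsColoop e)
    (h4 : ¬ ∃ W ⊆ M.E, W.ncard ≤ 9 ∧ W.encard = M.eRk W + 4)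
    (ht9 : {C : Set α | M.IsCircuit C ∧ C.ncard = 3}.ncard = 9) : RLS M 14 5 := by
  classical
  have hd : M.E.encard = M.eRank + ((7 : ℕ) : ℕ∞) := by
    rw [hR, ← M.ground_finite.cast_ncard_eq, hn]
    push_cast
    ring
  obtain ⟨-, hs4, hs5⟩ := caps_fourteen_seven_cf M hd hn hfree hK
  have hflat : ∀ X ⊆ M.E, M.eRk X ≤ 5 → X.ncard ≤ 8 := fun X hX hr => by
    have := S2.ncard_le_of_eRk_le_of_not_nullity M 4 9 (by norm_num) h4 hX (r := 5) (by norm_num) (by exact_mod_cast hr)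
    omega
  have hflat' : ∀ X ⊆ M.E, M.eRk X ≤ 4 → X.ncard ≤ 7 := fun X hX hr => by
    have := S2.ncard_le_of_eRk_le_of_not_nullity M 4 9 (by norm_num) h4 hX (r := 4) (by norm_num) (by exact_mod_cast hr)
    omega
  have hEcard : M.ground_finite.toFinset.card = 14 + 7 := by
    rw [← Set.ncard_eq_toFinset_card _ M.ground_finite]; exact hn
  have hL0 : ∀ e ∈ M.E, ¬ M.IsLoop e := not_isLoop_of_free M hfree
  have hs : ∀ e ∈ M.E, ∀ f ∈ M.E, e ≠ f → M.eRk {e, f} = 2 := by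
    intro e he f hf hef
    have h2 : (2 : ℕ∞) ≤ M.eRk {e, f} :=
      two_le_eRk_of_two_le_ncard_of_free M hfree (pair_subset he hf) (by rw [ncard_pair hef])
    have h3 : M.eRk {e, f} ≤ 2 := by
      have := M.eRk_le_encard {e, f}
      rwa [encard_pair hef] at this
    exact le_antisymm h3 h2
  have hC1 : ∀ L ⊆ M.E, M.eRk L = 2 → L.ncard ≤ 3 :=
    fun L hL hr => ncard_le_three_of_eRk_two M hs hfree hL hr
  have hcirc : ∀ C, M.IsCircuit C → 3 ≤ C.encard := three_le_encard_of_circuit M hL0 hs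
  have hTfin : {C : Set α | M.IsCircuit C ∧ C.ncard = 3}.Finite :=
    M.ground_finite.finite_subsets.subset (fun C hC => hC.1.subset_ground)
  have h9 : ∀ X ⊆ M.E, X.ncard ≤ 9 → X.encard ≤ M.eRk X + 3 := by
    intro X hX hX9
    by_contra hlt
    push Not at hlt
    have hk : M.eRk X + 4 ≤ X.encard := by
      have := Order.add_one_le_of_lt hlt
      rwa [add_assoc, show (3 : ℕ∞) + 1 = 4 by norm_num] at this
    obtain ⟨W', hW'X, hW'⟩ := S2.exists_subset_encard_eq_eRk_add M hX 4 hk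
    exact h4 ⟨W', hW'X.trans hX, (Set.ncard_le_ncard hW'X (M.ground_finite.subset hX)).trans hX9, hW'⟩
  have hs6 : {C : Set α | M.IsCircuit C ∧ C.ncard = 6}.ncard ≤ (7 + 5).choose 6 :=
    Matroid.ncard_circuits_le_choose_of_encard M hd 5
  norm_num [Nat.choose] at hs6
  have cellA : ∀ (U S m : ℕ) (A : ℚ), Matroid.topCount M 14 5 ≤ U → {X : Set α | X ⊆ M.E ∧ M.eRk X = M.eRank}.ncard ≤ S → m ≤ 1024 →
      1024 * (U : ℚ) ≤ ((1024 - m : ℕ) : ℚ) * 2 ^ (7 - 5) * (12417 : ℚ) →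
      (1024 : ℚ) * (A + (S : ℚ)) ≤ (m : ℚ) * 2 ^ 21 →
      ({X : Set α | X ⊆ M.E ∧ M.eRk X ≤ 5}.ncard : ℚ) ≤ A → RLS M 14 5 := by
    intro U S m A hU hS hm hpoly htail hA
    rw [RLS_iff]
    exact c025_core_five_cell_of_counts_xqictq5g M 14 7 (by norm_num) hR hn U hU _ hA S hS
      12417 (by norm_num) (phiK 14 5) (by rw [S2.phiK_fourteen_five]; norm_num) ⟨m, hm, hpoly, htail⟩
  -- the top count through the top `5`- and `6`-sets
  have hUsum := S2.topCount_mul_five_le_seven M hR hd hC1 hflat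
  -- the top `5`-sets are independent `5`-sets
  have htop5 : {B : Set α | B ⊆ M.E ∧ B.ncard = 5 ∧ M.eRk B = 5 ∧ M.eRk (M.E \ B) = M.eRank}.ncard ≤
      {B : Set α | B ⊆ M.E ∧ B.ncard = 5 ∧ M.eRk B = 5}.ncard :=
    Set.ncard_le_ncard (fun B hB => ⟨hB.1, hB.2.1, hB.2.2.1⟩)
      (M.ground_finite.finite_subsets.subset (fun B hB => hB.1))
  have hind5 := S2.ncard_indep_five_add_le (M := M) hC1
  rw [hn] at hind5
  norm_num [Nat.choose] at hind5
  -- the top `6`-sets through circuits, with a per-triangle charge `c`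
  have htop6_le : ∀ (c : ℕ), (∀ T : Set α, M.IsCircuit T → T.ncard = 3 →
      {B : Set α | B ⊆ M.E ∧ B.ncard = 6 ∧ T ⊆ B ∧ M.eRk (M.E \ B) = M.eRank}.ncard ≤ c) →
      {B : Set α | B ⊆ M.E ∧ B.ncard = 6 ∧ M.eRk B = 5 ∧ M.eRk (M.E \ B) = M.eRank}.ncard ≤
        {C : Set α | M.IsCircuit C ∧ C.ncard = 3}.ncard * c + 56 * 136 + 307 * 16 + 924 := by
    intro c hc
    have := S2.ncard_top_six_le_n M hn hcirc c hc
    norm_num [Nat.choose] at this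
    have h4' := Nat.mul_le_mul_right 136 hs4
    have h5' := Nat.mul_le_mul_right 16 hs5
    omega
  -- the per-triangle charge at `t = 9`: `≤ 530` in every configuration of the avoiding circuits
  have hc530 : ∀ T : Set α, M.IsCircuit T → T.ncard = 3 →
      {B : Set α | B ⊆ M.E ∧ B.ncard = 6 ∧ T ⊆ B ∧ M.eRk (M.E \ B) = M.eRank}.ncard ≤ 530 := by
    intro T hT hT3
    have hTfin' : T.Finite := M.ground_finite.subset hT.subset_ground
    have h7 := S2.ncard_triangles_le_seven_add_disjoint M hC1 h9 hT hT3
    have h𝒟fin : {C : Set α | M.IsCircuit C ∧ C.ncard = 3 ∧ Disjoint C T}.Finite :=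
      hTfin.subset (fun C hC => ⟨hC.1, hC.2.1⟩)
    have hZ : (M.E \ T).ncard = 18 := by
      rw [Set.ncard_sdiff hT.subset_ground hTfin', hn, hT3]
    -- the lever on an avoiding set of nullity `≥ 3` and `≤ u` points
    have lever : ∀ (P : Set α) (u : ℕ), P ⊆ M.E \ T → M.eRk P + 3 ≤ P.encard → P.ncard ≤ u → u ≤ 10 →
        {B : Set α | B ⊆ M.E ∧ B.ncard = 6 ∧ T ⊆ B ∧ M.eRk (M.E \ B) = M.eRank}.ncard ≤
          u.choose 2 * (18 - u) + u.choose 3 := by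
      intro P u hP hP3 hPu hu10
      have h := S2.ncard_top_six_through_le_of_nullity_three M hR hn hT.subset_ground hT3 hP hP3
      rw [hZ] at h
      refine h.trans ?_
      generalize P.ncard = v at hPu
      interval_cases u <;> interval_cases v <;> norm_num [Nat.choose]
    by_cases h3 : 3 ≤ {C : Set α | M.IsCircuit C ∧ C.ncard = 3 ∧ Disjoint C T}.ncard
    · -- (a) three avoiding triangles
      obtain ⟨D₁, D₂, D₃, hD₁, hD₂, hD₃, h12, h13, h23⟩ := (Set.two_lt_ncard_iff h𝒟fin).1 (by omega)
      have hP3 := S2.eRk_union_three_triangles_add_three_le M hC1 hD₁.1 hD₁.2.1 hD₂.1 hD₂.2.1 hD₃.1 hD₃.2.1 h12 h13 h23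
      have hP : D₁ ∪ D₂ ∪ D₃ ⊆ M.E \ T := by
        refine Set.union_subset (Set.union_subset ?_ ?_) ?_
        · exact Set.subset_sdiff.2 ⟨hD₁.1.subset_ground, hD₁.2.2⟩
        · exact Set.subset_sdiff.2 ⟨hD₂.1.subset_ground, hD₂.2.2⟩
        · exact Set.subset_sdiff.2 ⟨hD₃.1.subset_ground, hD₃.2.2⟩
      have hu : (D₁ ∪ D₂ ∪ D₃).ncard ≤ 9 := by
        have h1 := Set.ncard_union_le (D₁ ∪ D₂) D₃
        have h2 := Set.ncard_union_le D₁ D₂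
        have h3 := hD₁.2.1
        have h4 := hD₂.2.1
        have h5 := hD₃.2.1
        omega
      exact (lever _ 9 hP hP3 hu (by norm_num)).trans (by norm_num [Nat.choose])
    push Not at h3
    -- two avoiding triangles and a `4`-circuit avoiding `T`
    obtain ⟨D₁, D₂, hD₁, hD₂, h12⟩ := (Set.one_lt_ncard_iff h𝒟fin).1 (by omega)
    obtain ⟨Q, hQ, hQ4, hQT⟩ := S2.exists_four_circuit_disjoint_of_six_le M hC1 hs h9 hT hT3 (by omega)
    have hD₁E : D₁ ⊆ M.E \ T := Set.subset_sdiff.2 ⟨hD₁.1.subset_ground, hD₁.2.2⟩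
    have hD₂E : D₂ ⊆ M.E \ T := Set.subset_sdiff.2 ⟨hD₂.1.subset_ground, hD₂.2.2⟩
    have hQE : Q ⊆ M.E \ T := Set.subset_sdiff.2 ⟨hQ.subset_ground, hQT⟩
    have hD₁fin : D₁.Finite := M.ground_finite.subset hD₁.1.subset_ground
    have hD₂fin : D₂.Finite := M.ground_finite.subset hD₂.1.subset_ground
    have hU6 : (D₁ ∪ D₂).ncard ≤ 6 := by
      have := Set.ncard_union_le D₁ D₂
      have h3 := hD₁.2.1
      have h4 := hD₂.2.1
      omega
    by_cases hU5 : (D₁ ∪ D₂).ncard ≤ 5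
    · -- (b) the two triangles share a point: the plain hitting lever
      have h := S2.ncard_top_six_through_add_le M hR hn hT.subset_ground hT3 hD₁.1 hD₂.1 h12 hD₁.2.2 hD₂.2.2
      have hk : 13 ≤ ((M.E \ T) \ (D₁ ∪ D₂)).ncard := by
        rw [Set.ncard_sdiff (Set.union_subset hD₁E hD₂E) (hD₁fin.union hD₂fin), hZ]
        omega
      have hch : (13 : ℕ).choose 3 ≤ ((M.E \ T) \ (D₁ ∪ D₂)).ncard.choose 3 := Nat.choose_le_choose 3 hk
      rw [hZ] at h
      norm_num [Nat.choose] at h hch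
      omega
    push Not at hU5
    have hU6' : (D₁ ∪ D₂).ncard = 6 := by omega
    by_cases hQsub : Q ⊆ D₁ ∪ D₂
    · -- (d) `Q` inside the two disjoint triangles: `D₁ ∪ D₂ ⊆ cl Q`, rank `3`, nullity `3`
      have hdisj : Disjoint D₁ D₂ := by
        rw [Set.disjoint_iff_inter_eq_empty, ← Set.ncard_eq_zero (hD₁fin.subset Set.inter_subset_left)]
        have := Set.ncard_union_add_ncard_inter D₁ D₂ hD₁fin hD₂fin
        have h3 := hD₁.2.1
        have h4 := hD₂.2.1
        omega
      have hQfin : Q.Finite := M.ground_finite.subset hQ.subset_ground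
      -- `Q` meets each `Dᵢ` in exactly two points
      have hsplit : (Q ∩ D₁).ncard + (Q ∩ D₂).ncard = 4 := by
        rw [← hQ4, ← Set.ncard_union_eq (hdisj.mono Set.inter_subset_right Set.inter_subset_right)
          (hQfin.subset Set.inter_subset_left) (hQfin.subset Set.inter_subset_left), ← Set.inter_union_distrib_left,
          Set.inter_eq_left.2 hQsub]
      have hnot : ∀ {D : Set α}, M.IsCircuit D → D.ncard = 3 → (Q ∩ D).ncard ≤ 2 := by
        intro D hD hD3
        by_contra hlt
        push Not at hlt
        have hDfin : D.Finite := M.ground_finite.subset hD.subset_ground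
        have hle : D.ncard ≤ (Q ∩ D).ncard := by omega
        have heq : Q ∩ D = D := Set.eq_of_subset_of_ncard_le Set.inter_subset_right hle hDfin
        have hDQ : D ⊆ Q := by rw [← heq]; exact Set.inter_subset_left
        have := hD.eq_of_subset_isCircuit hQ hDQ
        rw [this, hQ4] at hD3
        omega
      have hcl : ∀ {D : Set α}, M.IsCircuit D → D.ncard = 3 → (Q ∩ D).ncard = 2 → D ⊆ M.closure Q := by
        intro D hD hD3 h2
        obtain ⟨a, b, hab, hQD⟩ := Set.ncard_eq_two.1 h2
        have haQ : a ∈ Q ∩ D := by rw [hQD]; exact Set.mem_insert a {b}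
        have hbQ : b ∈ Q ∩ D := by rw [hQD]; exact Set.mem_insert_of_mem a (Set.mem_singleton b)
        have hsub := S2.subset_closure_pair_of_dep_three M hs hD.subset_ground hD3 hD.dep haQ.2 hbQ.2 hab
        refine hsub.trans (M.closure_subset_closure ?_)
        exact Set.insert_subset haQ.1 (Set.singleton_subset_iff.2 hbQ.1)
      have h1 := hnot hD₁.1 hD₁.2.1
      have h2 := hnot hD₂.1 hD₂.2.1
      have hP3 : M.eRk (D₁ ∪ D₂) + 3 ≤ (D₁ ∪ D₂).encard := by
        have hsubcl : D₁ ∪ D₂ ⊆ M.closure Q :=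
          Set.union_subset (hcl hD₁.1 hD₁.2.1 (by omega)) (hcl hD₂.1 hD₂.2.1 (by omega))
        have hrk : M.eRk (D₁ ∪ D₂) ≤ 3 := by
          have hQr := hQ.eRk_add_one_eq
          rw [← hQfin.cast_ncard_eq, hQ4] at hQr
          have hQr' : M.eRk Q ≤ 3 := by
            have : M.eRk Q + 1 ≤ 3 + 1 := by rw [hQr]; norm_num
            exact (ENat.add_le_add_iff_right (by simp)).1 this
          calc M.eRk (D₁ ∪ D₂) ≤ M.eRk (M.closure Q) := M.eRk_mono hsubcl
            _ = M.eRk Q := M.eRk_closure_eq Q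
            _ ≤ 3 := hQr'
        rw [← (hD₁fin.union hD₂fin).cast_ncard_eq, hU6']
        calc M.eRk (D₁ ∪ D₂) + 3 ≤ 3 + 3 := by gcongr
          _ = ((6 : ℕ) : ℕ∞) := by norm_num
      exact (lever _ 6 (Set.union_subset hD₁E hD₂E) hP3 hU6'.le (by norm_num)).trans (by norm_num [Nat.choose])
    · -- (c) `Q` not inside `D₁ ∪ D₂`: the three circuits have a union of nullity `≥ 3` on `≤ 10` points
      have hP3 := S2.eRk_union_three_add_three_le_encard M hD₁.1 hD₂.1 hQ h12 hQsub
      have hu : (D₁ ∪ D₂ ∪ Q).ncard ≤ 10 := by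
        have := Set.ncard_union_le (D₁ ∪ D₂) Q
        omega
      exact (lever _ 10 (Set.union_subset (Set.union_subset hD₁E hD₂E) hQE) hP3 hu le_rfl).trans
        (by norm_num [Nat.choose])
  -- the spanning counts
  have hSkit : {X : Set α | X ⊆ M.E ∧ M.eRk X = M.eRank}.ncard ≤ 198440 := by
    have hS := Matroid.ncard_spanning_le (M := M) hd
    rw [hEcard] at hS
    exact hS.trans (by decide)
  have hspan3 : 3 ≤ {C : Set α | M.IsCircuit C ∧ C.ncard = 3}.ncard → {X : Set α | X ⊆ M.E ∧ M.eRk X = M.eRank}.ncard ≤ 137288 := by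
    intro h3
    obtain ⟨T₁, T₂, T₃, hT₁, hT₂, hT₃, h12, h13, h23⟩ := (Set.two_lt_ncard_iff hTfin).1 (by omega)
    have hS := S2.ncard_spanning_add_le_of_three_triangles M hR hn (by norm_num) hC1 hT₁.1 hT₁.2 hT₂.1 hT₂.2 hT₃.1 hT₃.2 h12 h13 h23
    norm_num [Finset.sum_range_succ, Nat.choose] at hS
    omega
  -- the exact triangle count `t` and the rank part of the tail at `t`
  obtain ⟨t, ht⟩ : ∃ t, {C : Set α | M.IsCircuit C ∧ C.ncard = 3}.ncard = t := ⟨_, rfl⟩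
  have hA := ncard_eRk_le_five_le_spread M 14 7 (by norm_num) hR hn hfree hflat hflat' t 56 307 ht.le hs4 hs5
  rw [ht] at ht9 hspan3 htop6_le hind5
  have hS' := hspan3 (by omega)
  have h530 := htop6_le 530 hc530
  subst ht9
  norm_num [Nat.choose] at hind5 h530
  have hU' : Matroid.topCount M 14 5 ≤ 44518 := by omega
  exact cellA _ 137288 103 _ hU' hS' (by norm_num) (by norm_num) (by norm_num [Nat.choose]) hA

end ThmN

end PercRepro
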